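import Summits.CriticalPhenomena.PercolationContinuityZ3.Theorems.PercNearOneGluingNoHeavyLowerTailStarSetForestCertificateTools
import HarnessLib

/-!
# `NoHeavyLowerTail` (stmt-CriticalPhenomena-4575) — aggregation of unit demands over cylinders (L2.2 of U1-PROOF.md; blueprint B5)

Support file (prover `prim-gen-swap` gen 13; `--supports stmt-CriticalPhenomena-4575`).  No definitions, no named facts, no sorries.

L2.2 of the seat memo U1-PROOF.md: the total pattern weight `W(S) = Π_S θ Π_{∉S}(1−θ)` of the configurations `S` containing a prescribed set `O` of
open classes (and avoiding a prescribed set `Cl` of closed ones) is the cylinder probability `Π_O θ · Π_Cl (1−θ)` (`StarSet.cylinder_sum`); hence any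
family of units supported on such configurations, each configuration weighted by a factor in `[0,1]` (e.g. "one unit with this hub"), has total demand
at most `Π_O θ`.  These are the forms in which the load bounds of the charging scheme (regular pairs `O = {X,Y}`, rider words `O = {X,J,ρ}`, A0
triangles `O = Δ`, overflow streams) consume L2.2.

* `StarSet.weighted_sum_le_cylinder` — `g ≤ 1`, `g S ≠ 0 ⇒ O ⊆ S ∧ Cl ∩ S = ∅` ⇒ `Σ_S W(S) g(S) ≤ Π_O θ · Π_Cl (1−θ)`;
* `StarSet.weighted_sum_le_cylinder_open` — the case `Cl = ∅`: `≤ Π_O θ`;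
* `StarSet.weighted_sum_le_pair`, `StarSet.weighted_sum_le_triple` — `O = {X,Y}` resp. `{X,Y,Z}` spelled out.
-/

namespace Summit.CriticalPhenomena.PercolationContinuityZ3.Theorems

open Finset
open scoped BigOperators

namespace StarSet

variable {ι : Type*} [Fintype ι] [DecidableEq ι]

/-- **L2.2 (aggregation over a cylinder).**  If `g ≤ 1` and `g(S) ≠ 0` forces `O ⊆ S` and `Cl ∩ S = ∅` (`O, Cl` disjoint), then
`Σ_S W(S)·g(S) ≤ Π_{O} θ · Π_{Cl} (1 − θ)`. -/
theorem weighted_sum_le_cylinder (θ : ι → ℝ) (hθ0 : ∀ i, 0 ≤ θ i) (hθ1 : ∀ i, θ i ≤ 1) (O Cl : Finset ι) (hOC : Disjoint O Cl)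
    (g : Finset ι → ℝ) (hg1 : ∀ S, g S ≤ 1) (hgO : ∀ S, g S ≠ 0 → O ⊆ S ∧ ∀ k ∈ Cl, k ∉ S) :
    ∑ S ∈ (univ : Finset ι).powerset, ((∏ k ∈ S, θ k) * ∏ k ∈ univ \ S, (1 - θ k)) * g S ≤
      (∏ k ∈ O, θ k) * ∏ k ∈ Cl, (1 - θ k) := by
  rw [← cylinder_sum θ O Cl hOC]
  refine sum_le_sum fun S _ => mul_le_mul_of_nonneg_left ?_
    (mul_nonneg (prod_nonneg fun k _ => hθ0 k) (prod_nonneg fun k _ => sub_nonneg.2 (hθ1 k)))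
  by_cases h : O ⊆ S ∧ ∀ k ∈ Cl, k ∉ S
  · rw [if_pos h]; exact hg1 S
  · rw [if_neg h]
    by_contra hne
    exact h (hgO S (fun h0 => hne (by rw [h0])))

/-- L2.2 with no closed constraint: `Σ_S W(S)·g(S) ≤ Π_{O} θ`. -/
theorem weighted_sum_le_cylinder_open (θ : ι → ℝ) (hθ0 : ∀ i, 0 ≤ θ i) (hθ1 : ∀ i, θ i ≤ 1) (O : Finset ι)
    (g : Finset ι → ℝ) (hg1 : ∀ S, g S ≤ 1) (hgO : ∀ S, g S ≠ 0 → O ⊆ S) :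
    ∑ S ∈ (univ : Finset ι).powerset, ((∏ k ∈ S, θ k) * ∏ k ∈ univ \ S, (1 - θ k)) * g S ≤ ∏ k ∈ O, θ k := by
  have h := weighted_sum_le_cylinder θ hθ0 hθ1 O ∅ (disjoint_empty_right O) g hg1
    (fun S hS => ⟨hgO S hS, fun k hk => absurd hk (Finset.notMem_empty k)⟩)
  rwa [prod_empty, mul_one] at h

/-- L2.2 for a pair: units supported on `{S ⊇ {X, Y}}`, one per configuration, have total demand `≤ θ_X θ_Y` (`X ≠ Y`). -/
theorem weighted_sum_le_pair (θ : ι → ℝ) (hθ0 : ∀ i, 0 ≤ θ i) (hθ1 : ∀ i, θ i ≤ 1) {X Y : ι} (hXY : X ≠ Y)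
    (g : Finset ι → ℝ) (hg1 : ∀ S, g S ≤ 1) (hgO : ∀ S, g S ≠ 0 → X ∈ S ∧ Y ∈ S) :
    ∑ S ∈ (univ : Finset ι).powerset, ((∏ k ∈ S, θ k) * ∏ k ∈ univ \ S, (1 - θ k)) * g S ≤ θ X * θ Y := by
  have h := weighted_sum_le_cylinder_open θ hθ0 hθ1 {X, Y} g hg1
    (fun S hS => by
      obtain ⟨hX, hY⟩ := hgO S hS
      intro k hk
      rcases mem_insert.1 hk with rfl | hk
      · exact hX
      · rw [mem_singleton.1 hk]; exact hY)
  rwa [prod_pair hXY] at h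

/-- L2.2 for a triple: units supported on `{S ⊇ {X, Y, Z}}`, one per configuration, have total demand `≤ θ_X θ_Y θ_Z` (distinct classes). -/
theorem weighted_sum_le_triple (θ : ι → ℝ) (hθ0 : ∀ i, 0 ≤ θ i) (hθ1 : ∀ i, θ i ≤ 1) {X Y Z : ι} (hXY : X ≠ Y) (hXZ : X ≠ Z)
    (hYZ : Y ≠ Z) (g : Finset ι → ℝ) (hg1 : ∀ S, g S ≤ 1) (hgO : ∀ S, g S ≠ 0 → X ∈ S ∧ Y ∈ S ∧ Z ∈ S) :
    ∑ S ∈ (univ : Finset ι).powerset, ((∏ k ∈ S, θ k) * ∏ k ∈ univ \ S, (1 - θ k)) * g S ≤ θ X * θ Y * θ Z := by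
  have h := weighted_sum_le_cylinder_open θ hθ0 hθ1 {X, Y, Z} g hg1
    (fun S hS => by
      obtain ⟨hX, hY, hZ⟩ := hgO S hS
      intro k hk
      rcases mem_insert.1 hk with rfl | hk
      · exact hX
      rcases mem_insert.1 hk with rfl | hk
      · exact hY
      · rw [mem_singleton.1 hk]; exact hZ)
  have hXYZ : X ∉ ({Y, Z} : Finset ι) := by simp [hXY, hXZ]
  rw [prod_insert hXYZ, prod_pair hYZ] at h
  linarith [h]

end StarSet

end Summit.CriticalPhenomena.PercolationContinuityZ3.Theorems
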